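import Summits.HubbardSuperconductivity.HubbardSuperconductivity.Theorems.AnisotropyChordTransferFibre3RowCNhi
import Summits.HubbardSuperconductivity.HubbardSuperconductivity.Theorems.AnisotropyChordTransferFibre3N1RowCheckC
import Summits.HubbardSuperconductivity.HubbardSuperconductivity.Theorems.AnisotropyChordTransferFibre3RowCExpr
import Summits.HubbardSuperconductivity.HubbardSuperconductivity.Theorems.AnisotropyChordTransferFibre3L2TCell
import Summits.HubbardSuperconductivity.HubbardSuperconductivity.Theorems.AnisotropyChordTransferFibre3RowCTNhi

/-!
# Route `AnisotropyChord` / H0 rotor rung, row C (KT-2b) on the t-BLOCKS `64 ≤ L < 128`: block twin of `…AnisotropyChordTransferFibre3RowCExpr`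

T-FORK (p1 g32, route-lead ruling R4-b; p2's inventory memo HOME/hubbard-h0-rotor-p2/TBLOCK-INVENTORY-g8.md §3–§4): the declarations of
`…RowCExpr` that carry the hypothesis `128 ≤ L` (or a constant that changes below `L = 128`, or the `L2.NamedCell` cell box) restated in the
namespace `RowC.T` with the SAME names for the t-blocks (route-lead ruling R1): analytic layer with `64 ≤ L` and the `L ≥ 64` numerics of p2 g8
(`ManifoldA.nu_ceiling64` (ν < .0359), `manifold_band64`, `second_shell_window64` (±.0012/±.003), `RowC.fmax_uniform64`/`gmin_uniform64`
(same constant .07 + .1ν), `third_shell_window64` (±.0031/±.01), `window_k10_64` ([.24993, .25]), `lam_increment_bound64` (δ = .0022)); cell layer on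
block cells `c : L2.TCell` (`cellFinalBoxCB (c.box a₁ a₂)`, `pmem_xTrueT`, `RowC.finalVec_mem_of_cellFinalBoxT`).  Declarations that do not change are NOT
duplicated (they resolve to `RowC`); proofs are verbatim up to the substitutions.
Prover seat `hubbard-h0-rotor-p1` g32 (route lead); helper for piece A = stmt-HubbardSuperconductivity-23918 of rung 19089 (`--supports`, helper
class).  Nothing here proves superconductivity in the Hubbard model; lemmas for ONE row of ONE conditional reduction on the t-blocks; the rotor TARGET
as originally worded stays FALSE (g15 verdict).  Mathlib + the tree only; no sorry.
-/

set_option linter.dupNamespace false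
set_option autoImplicit false

namespace Summit.HubbardSuperconductivity.HubbardSuperconductivity.Theorems.AnisotropyChord.Transfer.Fibre3

namespace RowC

namespace T

variable (L : ℕ) [NeZero L]

open Literature.Analysis.ValidatedNumerics

open L2.N1

/-- `δ`. -/
def delE : RExpr := .add etaE (.mul (cst 0.0022) csE)

/-- bulk. -/
def bulkE : RExpr :=
  .mul (.add (.add (.mul (.mul (cst 17) (.sq fnnE)) (.sq delE)) (.mul (.mul (cst 8) (.sq xiE)) (.sq MNE)))
    (.mul (.mul (cst 16) (.sq zeE)) (.sq MNE))) tauNE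

/-! ## The cell check -/


/-- the rational enclosure of `a_λ(1,1) ∈ [1/π − 0.0012, 1/π + 0.0012]`. -/
def k11I : ℚ × ℚ := (3171 / 10000, 3196 / 10000)

/-- the rational enclosure of `a_λ(2,0) ∈ [1 − 2/π − 0.003, 1 − 2/π + 0.003]`. -/
def k20I : ℚ × ℚ := (3603 / 10000, 3664 / 10000)


/-- the extended final box: p2's final box `F` plus the intervals of `x₄`, `a_λ(1,1)`, `a_λ(2,0)`. -/
def rowCBox (c : L2.TCell) (F : Box) : Box := F ++ [c.bS2, k11I, k20I]


/-! ## Evaluation lemmas -/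


section eval

/-- `bulkE` evaluates to `bulkN`. -/
theorem eval_bulkE (y : ℕ → ℝ) (hπ : y 1 = Real.pi ^ 2) : bulkE.eval y = bulkN (y 0) (y 2) (y 3) (y 10) (y 11) (y 12) := by
  have h1 := eval_tauNE y hπ
  obtain ⟨h2, h3⟩ := eval_xiE_zeE y hπ
  have he := eval_etaE y hπ
  have hc := eval_csE y hπ
  have hf := eval_fnnE y hπ
  have hm := eval_MNE y hπ
  simp only [bulkE, bulkN, delN, delE, cst, RExpr.eval] at *
  rw [h1, h2, h3, he, hc, hf, hm]; push_cast; ring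


end eval


end T

end RowC

end Summit.HubbardSuperconductivity.HubbardSuperconductivity.Theorems.AnisotropyChord.Transfer.Fibre3
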